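/-
Origin: expansion seat `planner-pub-hodgecm-pv01-g4-0`, handover #1 2026-08-18T06:32:19Z (`HOME/pub-hodgecm-pv01-g4/lean/Pv01g4/EndStateStrength.lean`, md5 e553b2be, 273 lines);
landed by the gen-7 packager in gate run 25 as `HodgeCM/PerL34/EndStateStrength.lean` (verbatim).
-/
/-
Origin: planner-pub-hodgecm-pv01-g4-0 (unit pub-hodgecm-pv01-g4, DAG-NODE PROVER #01 gen 4; lineage pv01 → pv01-g2 →
pv01-g3), 2026-08-18.  Proposed tree path: `HodgeCM/PerL34/EndStateStrength.lean` (new, additive; fresh namespace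
`HodgeCM.PerL34.EndStateStrength`).  Imports LANDED / run-24-STAGED tree modules only (no rewrite).
KERNEL: nothing cited, nothing asserted — every hypothesis is a binder the headline theorem
`AssemblyRoutes.perL_of_openCharsWeilLeavesCRΔ` ALREADY carries, plus the `T`-free residual `SplitHolConfig`
(pv02-g3, `S1StrengthCR`) and the DEFINITIONAL level-freeness of theta one-forms `T.Fact_coverTheta`
(`HodgeCM/Automorphic/HeckeWedge.lean`, consumed so far only by the Hecke route).
-/
import Summits.HodgeConjecture.HodgeCM.PerL34.S1StrengthCRDelta
import Summits.HodgeConjecture.HodgeCM.PerL34.SeesawDictionary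
import Summits.HodgeConjecture.HodgeCM.PerL34.ThetaSubOfLiu_2
import Summits.HodgeConjecture.HodgeCM.Automorphic.HeckeWedge
import Summits.HodgeConjecture.HodgeCM.Proofs.RealisationConstruction

/-!
# The S1 binder INSIDE the end state: `WeilStepsInputCRΔ T` ≡ A6 ∧ (a 0-type meet condition)

Referee A, round 17, G4 records the exact strength of the S1 binder `hW : CharSpansFinal.WeilStepsInputCRΔ T` of the
headline `AssemblyRoutes.perL_of_openCharsWeilLeavesCRΔ` as "A6-HEREDITARY strengthening (not ≡ A6)": pv02-g3's
kernel verdict (`S1StrengthCR.weilStepsInputCRΔ_iff`, run 24) is, over any `SplitHolConfig` and given node N31,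
  `WeilStepsInputCRΔ T ↔ StepsVacuity.Open_thetaWedgeHereditary T ∧ S1StrengthCR.CharsNonempty T`,
where `Open_thetaWedgeHereditary` = "(i) below some level `Γ₀` EVERY level carries a non-zero theta wedge, and (ii)
`Θ₀(Γ) ∩ Θ₁(Γ) ≠ ∅`", and pv03-g2's `StepsVacuity` docstring leaves "(i) vs A6" as a difference "invisible in the
intended model".  This file removes the two differences that carry content — hereditary (i) vs A6, and
`CharsNonempty` — INSIDE THE END STATE, i.e. in the presence of the headline's other binders, leaving exactly the
0-type conjunct (ii) (`ThetaMeet`):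

* §1 `hereditary_iff`: `Open_thetaWedgeHereditary T ↔ HereditaryWedge T ∧ ThetaMeet T` — conjunct (ii) split off
  (`levelDirected` glues the two levels back);
* §2 `hereditaryWedge_of_thetaWedge`: **A6 (`T.Open_thetaWedge`, node N33, PerL Prop 4.3's conclusion) ⇒ hereditary
  (i)**, from `Open_thetaSub` (N12a), Hodge–Riemann (N07), `Fact_embCover` (N09a), `Fact_innerEmb` (N09b), the model
  axioms (`pull_cup`, `pull_hodge`, `cup2_hodge`, `pms_dim`) and the DEFINITIONAL `Fact_coverTheta`: pull the wedge
  back along the covering `P_Γ → P_{Γ₀}`; its `L²` function is unchanged (`Fact_embCover` ∘ `pullC_cup2C`) and was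
  non-zero (`ThetaModel.emb_ne_zero`: Petersson = cup pairing + Hodge–Riemann (2,0)), so the pulled-back wedge of
  the pulled-back (still theta, `Fact_coverTheta`) one-forms is non-zero;
* §3 `charsNonempty_of_thetaGen12`: **the conjunct `CharsNonempty T` is paid by the headline's own binders** —
  A6 + N19w (`Open_thetaGen12`, from the seesaw bridges `hbr` and `hch` by `SeesawDictionary.open_thetaGen12_of_bridges`)
  + N12a/N07/N09b: `Λ_Γ ω₁ ω₂ = emb_Γ(ω₁ ∪ ω₂) ≠ 0` lies in `S₁₂ = closure (span {ϑ_χ(Φ) : χ allowed})`, which is `⊥`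
  when the character set `X` is empty; at dictionary level (`charsNonempty_of_genIdentity` / `_of_bridges`) even
  without non-vanishing: the (12) generator identity names a character `χ` for any theta pair;
* §4 the verdicts: `weilStepsInputCRΔ_iff_thetaWedge` / `weilStepsInputCR_iff_thetaWedge` (leaf form) and
  `weilStepsInputCRΔ_iff_thetaWedge_of_leaves` (the headline's literal binders `M h07 h09a h09b hM38 hAlb hbr hch`):
  **`WeilStepsInputCRΔ T ↔ T.Open_thetaWedge ∧ ThetaMeet T`**, modulo `SplitHolConfig` (only for `←`) and
  `Fact_coverTheta`.  So inside the end state the S1 binder is node N33's A6 ON THE NOSE up to `ThetaMeet`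
  ("below some level the two theta sets meet" — in the intended model `0 = u_0 ∈ Θ₀(Γ) ∩ Θ₁(Γ)`; a condition of
  0-type on the posited sets, carrying no wedge/non-vanishing content), and `hereditary_of_thetaWedge` gives the
  S1 target `Open_thetaWedgeHereditary T` from A6 + `ThetaMeet`.
Nothing here closes A6 itself (PerL Prop 4.3 — node N33, the heart: `AssemblyRoutes.N33_wedge_of_weil_chars` from
`hW`, `ThetaWedgeSplit.thetaWedge_of_ball`, `HeckeWedge`'s `thetaWedge_of_hecke` for `[L:ℚ] ≥ 4`), nor inhabits the
`T`-free `SplitHolConfig` (pv02-g3's residual `SplitHolForms.OrbitSpansDisjoint`).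
-/

set_option autoImplicit false

noncomputable section

namespace HodgeCM
namespace PerL34
namespace EndStateStrength

open HodgeCM.PerL34.StepsVacuity HodgeCM.PerL34.S1StrengthCR HodgeCM.PerL34.CharSpansFinal
  HodgeCM.PerL34.CharSpansCR HodgeCM.PerL34.CharSpansWeil

variable {U : Universe} (T : U.ThetaModel)

/-! ## 1. Splitting the hereditary binder -/

/-- Conjunct (i) of `Open_thetaWedgeHereditary`, alone: below some level every level carries a non-zero theta
wedge of types `(Ψ₀, Ψ₁)`. -/
def HereditaryWedge : Prop :=
  ∀ {L : CMField} {ι₁ : L →+* ℂ} (V : HermSpace3 L ι₁) (c : SeesawCtx L), T.GoodCtx ι₁ c →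
    ∃ Γ₀ : Level V, ∀ Γ : Level V, Γ.Γ ≤ Γ₀.Γ →
      ∃ ω₁ ∈ T.Theta V c 0 Γ, ∃ ω₂ ∈ T.Theta V c 1 Γ, U.cup2C (U.pms L ι₁ V Γ) 1 ω₁ ω₂ ≠ 0

/-- Conjunct (ii) of `Open_thetaWedgeHereditary`, alone: below some level the theta sets of types `Ψ₀` and `Ψ₁`
meet (in the intended model: `0 = u_0` lies in both). -/
def ThetaMeet : Prop :=
  ∀ {L : CMField} {ι₁ : L →+* ℂ} (V : HermSpace3 L ι₁) (c : SeesawCtx L), T.GoodCtx ι₁ c →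
    ∃ Γ₀ : Level V, ∀ Γ : Level V, Γ.Γ ≤ Γ₀.Γ → (T.Theta V c 0 Γ ∩ T.Theta V c 1 Γ).Nonempty

/-- `Open_thetaWedgeHereditary T ↔ HereditaryWedge T ∧ ThetaMeet T` (a common refinement of the two levels,
`levelDirected`, glues the conjuncts back). -/
theorem hereditary_iff : Open_thetaWedgeHereditary T ↔ HereditaryWedge T ∧ ThetaMeet T := by
  refine ⟨fun h => ⟨fun V c hc => ?_, fun V c hc => ?_⟩, fun h => fun V c hc => ?_⟩
  · obtain ⟨Γ₀, hΓ₀⟩ := h V c hc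
    exact ⟨Γ₀, fun Γ hΓ => (hΓ₀ Γ hΓ).1⟩
  · obtain ⟨Γ₀, hΓ₀⟩ := h V c hc
    exact ⟨Γ₀, fun Γ hΓ => (hΓ₀ Γ hΓ).2⟩
  · obtain ⟨Γ₁, hΓ₁⟩ := h.1 V c hc
    obtain ⟨Γ₂, hΓ₂⟩ := h.2 V c hc
    obtain ⟨Γ₀, h₁, h₂⟩ := levelDirected _ _ V Γ₁ Γ₂
    exact ⟨Γ₀, fun Γ hΓ => ⟨hΓ₁ Γ (hΓ.trans h₁), hΓ₂ Γ (hΓ.trans h₂)⟩⟩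

/-! ## 2. A6 ⇒ hereditary (i), under level-freeness of theta one-forms -/

/-- Theta one-forms are holomorphic (`Open_thetaSub`: `Θ_i(Γ) ⊆ U_{Ψ_i}(Γ) ⊆ H^{1,0}`). -/
theorem theta_mem_H10 (M : U.ModelAxioms) (hsub : T.Open_thetaSub) {L : CMField} {ι₁ : L →+* ℂ}
    (V : HermSpace3 L ι₁) (c : SeesawCtx L) (hc : T.GoodCtx ι₁ c) (i : Fin 4) (Γ : Level V)
    {ω : U.CohC (U.pms L ι₁ V Γ) 1} (hω : ω ∈ T.Theta V c i Γ) : ω ∈ U.H10 (U.pms L ι₁ V Γ) :=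
  U.Uiso_le_H10 M.pull_hodge Γ c.K (c.Ψ i) c.σ (hsub V c hc i Γ hω)

/-- The `L²` function of a non-zero wedge of theta one-forms is non-zero (`ThetaModel.emb_ne_zero`: Petersson =
cup pairing `Fact_innerEmb` + Hodge–Riemann (2,0) `Fact_hodgeRiemann20`). -/
theorem emb_cup_ne_zero (M : U.ModelAxioms) (hHR : U.Fact_hodgeRiemann20) (hI : T.Fact_innerEmb)
    (hsub : T.Open_thetaSub) {L : CMField} {ι₁ : L →+* ℂ} (V : HermSpace3 L ι₁) (c : SeesawCtx L)
    (hc : T.GoodCtx ι₁ c) (Γ : Level V) {ω₁ ω₂ : U.CohC (U.pms L ι₁ V Γ) 1} (h₁ : ω₁ ∈ T.Theta V c 0 Γ)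
    (h₂ : ω₂ ∈ T.Theta V c 1 Γ) (hne : U.cup2C (U.pms L ι₁ V Γ) 1 ω₁ ω₂ ≠ 0) :
    T.emb Γ (U.cup2C (U.pms L ι₁ V Γ) 1 ω₁ ω₂) ≠ 0 :=
  T.emb_ne_zero M hI hHR Γ
    (Universe.cup2C_mem_F2 M _ (theta_mem_H10 T M hsub V c hc 0 Γ h₁) (theta_mem_H10 T M hsub V c hc 1 Γ h₂)) hne

/-- **Pull-back of a non-zero theta wedge stays non-zero**: for `Γ ≤ Γ₀` and theta one-forms `ω₁, ω₂` at level
`Γ₀` with `ω₁ ∪ ω₂ ≠ 0`, `π^*ω₁ ∪ π^*ω₂ ≠ 0` for the covering `π : P_Γ → P_{Γ₀}` — because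
`emb_Γ(π^*(ω₁ ∪ ω₂)) = emb_{Γ₀}(ω₁ ∪ ω₂) ≠ 0` (`Fact_embCover`, `emb_cup_ne_zero`) and `π^*` is multiplicative
(`Fact_pull_cup`, complexified: `Universe.pullC_cup2C`). -/
theorem cup_pullC_ne_zero (M : U.ModelAxioms) (hHR : U.Fact_hodgeRiemann20) (hE : T.Fact_embCover)
    (hI : T.Fact_innerEmb) (hsub : T.Open_thetaSub) {L : CMField} {ι₁ : L →+* ℂ} (V : HermSpace3 L ι₁)
    (c : SeesawCtx L) (hc : T.GoodCtx ι₁ c) (Γ₀ Γ : Level V) (hΓ : Γ.Γ ≤ Γ₀.Γ)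
    {ω₁ ω₂ : U.CohC (U.pms L ι₁ V Γ₀) 1} (h₁ : ω₁ ∈ T.Theta V c 0 Γ₀) (h₂ : ω₂ ∈ T.Theta V c 1 Γ₀)
    (hne : U.cup2C (U.pms L ι₁ V Γ₀) 1 ω₁ ω₂ ≠ 0) :
    U.cup2C (U.pms L ι₁ V Γ) 1 (U.pullC (T.cover Γ₀ Γ hΓ) 1 ω₁) (U.pullC (T.cover Γ₀ Γ hΓ) 1 ω₂) ≠ 0 := by
  intro h0
  apply emb_cup_ne_zero T M hHR hI hsub V c hc Γ₀ h₁ h₂ hne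
  have e2 : U.pullC (T.cover Γ₀ Γ hΓ) 2 (U.cup2C (U.pms L ι₁ V Γ₀) 1 ω₁ ω₂) =
      U.cup2C (U.pms L ι₁ V Γ) 1 (U.pullC (T.cover Γ₀ Γ hΓ) 1 ω₁) (U.pullC (T.cover Γ₀ Γ hΓ) 1 ω₂) :=
    Universe.pullC_cup2C M.pull_cup _ 1 ω₁ ω₂
  rw [← hE Γ₀ Γ hΓ, e2, h0, map_zero]

/-- **A6 ⇒ hereditary (i)**: under `Fact_coverTheta` (pull-backs of theta one-forms are theta one-forms) the
non-zero theta wedge at `Γ₀` given by `Open_thetaWedge` pulls back to a non-zero theta wedge at every `Γ ≤ Γ₀`. -/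
theorem hereditaryWedge_of_thetaWedge (M : U.ModelAxioms) (hHR : U.Fact_hodgeRiemann20)
    (hE : T.Fact_embCover) (hI : T.Fact_innerEmb) (hsub : T.Open_thetaSub) (hcov : T.Fact_coverTheta)
    (hw : T.Open_thetaWedge) : HereditaryWedge T := by
  intro L ι₁ V c hc
  obtain ⟨Γ₀, ω₁, h₁, ω₂, h₂, hne⟩ := hw V c hc
  exact ⟨Γ₀, fun Γ hΓ => ⟨_, hcov V c 0 Γ₀ Γ hΓ ω₁ h₁, _, hcov V c 1 Γ₀ Γ hΓ ω₂ h₂,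
    cup_pullC_ne_zero T M hHR hE hI hsub V c hc Γ₀ Γ hΓ h₁ h₂ hne⟩⟩

/-- Conversely hereditary (i) ⇒ A6 (take `Γ := Γ₀`). -/
theorem thetaWedge_of_hereditaryWedge (h : HereditaryWedge T) : T.Open_thetaWedge := by
  intro L ι₁ V c hc
  obtain ⟨Γ₀, hΓ₀⟩ := h V c hc
  exact ⟨Γ₀, hΓ₀ Γ₀ le_rfl⟩

/-- Hence, with these leaves in hand, hereditary (i) IS A6. -/
theorem hereditaryWedge_iff_thetaWedge (M : U.ModelAxioms) (hHR : U.Fact_hodgeRiemann20)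
    (hE : T.Fact_embCover) (hI : T.Fact_innerEmb) (hsub : T.Open_thetaSub) (hcov : T.Fact_coverTheta) :
    HereditaryWedge T ↔ T.Open_thetaWedge :=
  ⟨thetaWedge_of_hereditaryWedge T, hereditaryWedge_of_thetaWedge T M hHR hE hI hsub hcov⟩

/-- And the full hereditary binder is A6 ∧ `ThetaMeet`. -/
theorem hereditary_iff_thetaWedge (M : U.ModelAxioms) (hHR : U.Fact_hodgeRiemann20)
    (hE : T.Fact_embCover) (hI : T.Fact_innerEmb) (hsub : T.Open_thetaSub) (hcov : T.Fact_coverTheta) :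
    Open_thetaWedgeHereditary T ↔ T.Open_thetaWedge ∧ ThetaMeet T := by
  rw [hereditary_iff, hereditaryWedge_iff_thetaWedge T M hHR hE hI hsub hcov]

/-- In particular A6 + `ThetaMeet` give the S1 target `Open_thetaWedgeHereditary T`. -/
theorem hereditary_of_thetaWedge (M : U.ModelAxioms) (hHR : U.Fact_hodgeRiemann20)
    (hE : T.Fact_embCover) (hI : T.Fact_innerEmb) (hsub : T.Open_thetaSub) (hcov : T.Fact_coverTheta)
    (hw : T.Open_thetaWedge) (hm : ThetaMeet T) : Open_thetaWedgeHereditary T :=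
  (hereditary_iff_thetaWedge T M hHR hE hI hsub hcov).2 ⟨hw, hm⟩

/-! ## 3. `CharsNonempty` is paid by the end state's own binders -/

/-- If the side-(12) character set is empty then `S₁₂ = ⊥` (`TorusData.S12_def`: the closure of a span indexed by
the allowed characters). -/
theorem S12_eq_bot_of_isEmpty {L : CMField} {ι₁ : L →+* ℂ} (V : HermSpace3 L ι₁) (c : SeesawCtx L)
    [hX : IsEmpty (T.t12 V c).X] : (T.t12 V c).S12 = ⊥ := by
  refine le_bot_iff.1 ?_
  rw [(T.t12 V c).S12_def]
  refine Submodule.topologicalClosure_minimal _ (Submodule.span_le.mpr ?_) ?_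
  · rintro u ⟨χ, -, -⟩
    exact isEmptyElim χ
  · rw [Submodule.bot_coe]
    exact isClosed_singleton

/-- **A non-empty character set from A6 + N19w**: in a good context carrying a non-zero theta wedge (A6) whose
`L²` function lies in `S₁₂` (`Open_thetaGen12`, node N19w), the side-(12) character set is non-empty — else
`S₁₂ = ⊥ ∌ Λ_Γ ω₁ ω₂ = emb_Γ(ω₁ ∪ ω₂) ≠ 0`. -/
theorem nonempty_chars_of_thetaGen12 (M : U.ModelAxioms) (hHR : U.Fact_hodgeRiemann20) (hI : T.Fact_innerEmb)
    (hsub : T.Open_thetaSub) (hgen : T.Open_thetaGen12) {L : CMField} {ι₁ : L →+* ℂ} (V : HermSpace3 L ι₁)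
    (c : SeesawCtx L) (hc : T.GoodCtx ι₁ c) (Γ : Level V) {ω₁ ω₂ : U.CohC (U.pms L ι₁ V Γ) 1}
    (h₁ : ω₁ ∈ T.Theta V c 0 Γ) (h₂ : ω₂ ∈ T.Theta V c 1 Γ) (hne : U.cup2C (U.pms L ι₁ V Γ) 1 ω₁ ω₂ ≠ 0) :
    Nonempty (T.t12 V c).X := by
  by_contra hX
  haveI : IsEmpty (T.t12 V c).X := not_nonempty_iff.mp hX
  have hmem : T.Λ Γ ω₁ ω₂ ∈ (T.t12 V c).S12 := hgen V c hc Γ ω₁ ω₂ h₁ h₂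
  rw [S12_eq_bot_of_isEmpty T V c, Submodule.mem_bot, T.Λ_apply] at hmem
  exact emb_cup_ne_zero T M hHR hI hsub V c hc Γ h₁ h₂ hne hmem

/-- **`CharsNonempty T` from A6 (N33), N19w, N12a, N07, N09b** — all of them binders (or one step below binders)
of the headline theorem. -/
theorem charsNonempty_of_thetaGen12 (M : U.ModelAxioms) (hHR : U.Fact_hodgeRiemann20) (hI : T.Fact_innerEmb)
    (hsub : T.Open_thetaSub) (hw : T.Open_thetaWedge) (hgen : T.Open_thetaGen12) : CharsNonempty T := by
  intro L ι₁ V c hc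
  obtain ⟨Γ, ω₁, h₁, ω₂, h₂, hne⟩ := hw V c hc
  exact nonempty_chars_of_thetaGen12 T M hHR hI hsub hgen V c hc Γ h₁ h₂ hne

/-- The dictionary-level variant, hypothesis-light: A6 + the (12) generator identity `N19w_genIdentity` (the leaf
below N19w delivered by the seesaw bridges, `SeesawDictionary.N19w_genIdentity_of_bridge`) already NAME a character
for the wedge — no non-vanishing needed. -/
theorem charsNonempty_of_genIdentity (hw : T.Open_thetaWedge)
    (hgen : ∀ {L : CMField} {ι₁ : L →+* ℂ} (V : HermSpace3 L ι₁) (c : SeesawCtx L), T.GoodCtx ι₁ c →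
      N19w_genIdentity T V c (T.t12 V c) 0 1) : CharsNonempty T := by
  intro L ι₁ V c hc
  obtain ⟨Γ, ω₁, h₁, ω₂, h₂, -⟩ := hw V c hc
  obtain ⟨χ, -⟩ := hgen V c hc Γ ω₁ h₁ ω₂ h₂
  exact ⟨χ⟩

/-- The same from the seesaw-bridge binder `hbr` of the headline. -/
theorem charsNonempty_of_bridges (hw : T.Open_thetaWedge)
    (hbr : ∀ {L : CMField} {ι₁ : L →+* ℂ} (V : HermSpace3 L ι₁) (c : SeesawCtx L), T.GoodCtx ι₁ c →
      Nonempty (SeesawDictionary.SeesawBridge T V c (T.t12 V c) 0 1)) : CharsNonempty T :=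
  charsNonempty_of_genIdentity T hw fun V c hc =>
    (hbr V c hc).elim fun B => SeesawDictionary.N19w_genIdentity_of_bridge B

/-! ## 4. The verdicts: the S1 binder inside the end state -/

/-- **Leaf form, final binder.** Given N07, N09a, N09b, N12a, N19w, N31, the `T`-free `SplitHolConfig` and
`Fact_coverTheta`: `WeilStepsInputCRΔ T ↔ A6 ∧ ThetaMeet`.  (`→` uses only `hch`.) -/
theorem weilStepsInputCRΔ_iff_thetaWedge (M : U.ModelAxioms) (hHR : U.Fact_hodgeRiemann20)
    (hE : T.Fact_embCover) (hI : T.Fact_innerEmb) (hsub : T.Open_thetaSub) (hgen : T.Open_thetaGen12)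
    (hch : T.Open_chars) (C : SplitHolConfig) (hcov : T.Fact_coverTheta) :
    WeilStepsInputCRΔ T ↔ T.Open_thetaWedge ∧ ThetaMeet T := by
  constructor
  · intro h
    have hh : Open_thetaWedgeHereditary T := hereditary_of_CR T hch (weilStepsInputCR_of_CRΔ T h)
    exact ⟨open_thetaWedge_of_hereditary T hh, ((hereditary_iff T).1 hh).2⟩
  · rintro ⟨hw, hm⟩
    exact weilStepsInputCRΔ_of_hereditary T C (charsNonempty_of_thetaGen12 T M hHR hI hsub hw hgen)
      (hereditary_of_thetaWedge T M hHR hE hI hsub hcov hw hm)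

/-- The same for the CR binder `S1StrengthCR`/`CharSpansCR.WeilStepsInputCR T`. -/
theorem weilStepsInputCR_iff_thetaWedge (M : U.ModelAxioms) (hHR : U.Fact_hodgeRiemann20)
    (hE : T.Fact_embCover) (hI : T.Fact_innerEmb) (hsub : T.Open_thetaSub) (hgen : T.Open_thetaGen12)
    (hch : T.Open_chars) (C : SplitHolConfig) (hcov : T.Fact_coverTheta) :
    WeilStepsInputCR T ↔ T.Open_thetaWedge ∧ ThetaMeet T :=
  (weilStepsInputCRΔ_iff_CR T C hch).symm.trans (weilStepsInputCRΔ_iff_thetaWedge T M hHR hE hI hsub hgen hch C hcov)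

/-- The same for pv03's `CharSpansWeil.WeilStepsInput T`. -/
theorem weilStepsInput_iff_thetaWedge (M : U.ModelAxioms) (hHR : U.Fact_hodgeRiemann20)
    (hE : T.Fact_embCover) (hI : T.Fact_innerEmb) (hsub : T.Open_thetaSub) (hgen : T.Open_thetaGen12)
    (hch : T.Open_chars) (C : SplitHolConfig) (hcov : T.Fact_coverTheta) :
    WeilStepsInput T ↔ T.Open_thetaWedge ∧ ThetaMeet T :=
  ((weilStepsInput_iff T C hch).trans (weilStepsInputCR_iff T C hch).symm).trans
    (weilStepsInputCR_iff_thetaWedge T M hHR hE hI hsub hgen hch C hcov)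

/-- **`→` alone needs nothing but N31**: the final binder gives A6 and `ThetaMeet`. -/
theorem thetaWedge_and_meet_of_CRΔ (hch : T.Open_chars) (h : WeilStepsInputCRΔ T) :
    T.Open_thetaWedge ∧ ThetaMeet T :=
  have hh : Open_thetaWedgeHereditary T := hereditary_of_CR T hch (weilStepsInputCR_of_CRΔ T h)
  ⟨open_thetaWedge_of_hereditary T hh, ((hereditary_iff T).1 hh).2⟩

/-- **End-state form, with the headline's literal binders.** Given the binders `M h07 h09a h09b hM38 hAlb hbr hch`
of `AssemblyRoutes.perL_of_openCharsWeilLeavesCRΔ` (N12a by `ThetaModel.open_thetaSub_of_split`, N19w by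
`SeesawDictionary.open_thetaGen12_of_bridges`), the `T`-free `SplitHolConfig` and `Fact_coverTheta`, its S1 binder
`hW : WeilStepsInputCRΔ T` is equivalent to node N33's A6 together with `ThetaMeet T`. -/
theorem weilStepsInputCRΔ_iff_thetaWedge_of_leaves (M : U.ModelAxioms) (h07 : N07_hodgeRiemann20 U)
    (h09a : N09a_embCover T) (h09b : N09b_innerEmb T) (hM38 : U.Fact_cmInflation)
    (hAlb : T.Fact_thetaAlbanese)
    (hbr : ∀ {L : CMField} {ι₁ : L →+* ℂ} (V : HermSpace3 L ι₁) (c : SeesawCtx L), T.GoodCtx ι₁ c →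
      Nonempty (SeesawDictionary.SeesawBridge T V c (T.t12 V c) 0 1))
    (hch : T.Open_chars) (C : SplitHolConfig) (hcov : T.Fact_coverTheta) :
    WeilStepsInputCRΔ T ↔ T.Open_thetaWedge ∧ ThetaMeet T :=
  weilStepsInputCRΔ_iff_thetaWedge T M ((N07_iff U).mp h07) ((N09a_iff T).mp h09a) ((N09b_iff T).mp h09b)
    (T.open_thetaSub_of_split M hM38 hAlb) (SeesawDictionary.open_thetaGen12_of_bridges T hbr hch) hch C hcov

end EndStateStrength
end PerL34
end HodgeCM

end
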